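import Literature.NumberTheory.Automorphic.AutomorphicFormsGKModuleProofs
import Literature.NumberTheory.Automorphic.AutomorphicRepLieActionGL
import Literature.NumberTheory.Automorphic.AutomorphyDatumGLRegular
import Literature.NumberTheory.Automorphic.GKModulesOneParameter
import Literature.NumberTheory.Automorphic.ArchimedeanGLn
import Mathlib.Analysis.SpecialFunctions.Complex.Log
import Mathlib.LinearAlgebra.Matrix.ConjTranspose
import HarnessLib

/-!
# Torus integrality and `U(2)`-stable finite-dimensional subspaces at a complex place

Topic `NumberTheory/Automorphic`. Let `π = W / W'` be an automorphic representation datum of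
`GL₂(𝔸_K)` (`AutomorphicRepData (AutomorphyDatum.gl 2 K hcpt)`, Borel–Jacquet 1979, 4.6) and
`w` a complex place of the number field `K`, so that
`𝔤𝔩₂(ℂ) = 𝔤𝔩₂(K_w) ↪ 𝔤_∞ = 𝔤𝔩₂(K_∞)` (`complexPlaceLie 2 w`) and `U(2) = U(2, K_w) ⊆ K_∞`.
By the tree's proved `AutomorphicRepData.isGKModule_of_hasLieAction_holds`, `W / W'` with the
right translation `π.kRep` of `K_∞` and the Lie derivatives `π.lieRep` is a `(𝔤, K)`-module
(Wallach, *Real Reductive Groups I*, §3.3.1), and the elementary one-parameter-subgroup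
consequences of the axioms (`GKModulesOneParameter`) give the two analytic inputs of the
minimal-`U(2)`-type argument for the `GL₂(ℂ)`-component of `π` (Clozel 1990, §3.3; folklore):

* `AutomorphicRepData.torusIntegrality_complexPlace_glTwo`, part (a): every vector of `W / W'`
  lies in a finite-dimensional subspace (the span of its `K_∞`-orbit, `kFinite`) stable under
  `π.lieRep (complexPlaceLie 2 w Y)` for every skew-Hermitian `Y ∈ 𝔲(2)` (a `K`-stable subspace
  is `𝔨`-stable, `IsGKModule.apply_mem_of_expK_stable`);
* part (b): the weights of the torus `U(1) × U(1) ⊆ U(2)` are integral: if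
  `π.lieRep (i E_{aa})_w u = c u` with `u ≠ 0` then `c ∈ i ℤ`, because
  `exp (2π i E_{aa})_w = 1` in `K_∞` (`IsGKModule.exp_mul_eq_one_of_eigenvector`,
  `Complex.exp_eq_one_iff`).

Auxiliary (all proved): `star_complexPlaceLie`
(`star ∘ complexPlaceLie = complexPlaceLie ∘ ᴴ`),
`complexPlaceLie_mem_compactLie_archGroupGL` (`𝔲(n) ↪ 𝔨`),
`exp_complexPlaceHom_of_exp_eq_one`, `expK_two_pi_smul_eq_one_of_coe_eq_complexPlaceLie_single`
(`exp (2π (i E_{aa})_w) = 1` in `K_∞`).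

## Mathlib / Literature search

Tree: `IsGKModule` (`GKModules`), `IsGKModule.apply_mem_of_expK_stable`,
`IsGKModule.exp_mul_eq_one_of_eigenvector` (`GKModulesOneParameter`),
`AutomorphicRepData.isGKModule_of_hasLieAction_holds`, `AutomorphyDatum.isRegular_gl`,
`AutomorphicRepData.hasLieAction_lieRep`, `complexPlaceLie_apply`,
`RealMatrixGroup.mem_compactLie_iff`.
Mathlib: `Matrix.conjTranspose_single`, `Matrix.diagonal_single`, `Matrix.diagonal_map`,
`Matrix.exp_diagonal`, `Prod.fst_exp`, `Prod.snd_exp`, `Pi.coe_exp`, `Complex.exp_eq_exp_ℂ`,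
`Complex.exp_two_pi_mul_I`, `Complex.exp_eq_one_iff`.  Nothing here duplicates an existing
declaration
(`lean search 'star_complexPlaceLie|exp_complexPlaceHom|expK_two_pi|torusIntegrality'`: no hits).

## Design note

No `attribute [local instance] LieRing.ofAssociativeRing` is needed here: the commutator Lie
structures on `𝔤𝔩ₙ(K_∞)` occurring in the types of `complexPlaceLie`, `RealMatrixGroup.compactLie`
and `π.lieRep` are inherited by unification (the proofs never name `LieSubalgebra.inclusion`).

## References

* N. R. Wallach, *Real Reductive Groups I*, Academic Press 1988, §3.3.1. [WallachRRG1]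
* L. Clozel, *Motifs et formes automorphes*, in: Automorphic forms, Shimura varieties, and
  L-functions I, Academic Press 1990, §3.3. [Clozel1990]
* A. Borel, H. Jacquet, *Automorphic forms and automorphic representations*, Proc. Sympos. Pure
  Math. 33 (1979), part 1, 4.6. [BorelJacquet1979]
-/

open scoped Matrix Classical ComplexConjugate
open NumberField NumberField.InfinitePlace NumberField.mixedEmbedding

noncomputable section

namespace Literature.NumberTheory.Automorphic

variable {K : Type} [Field K]

/-- The inclusion `𝔤𝔩ₙ(ℂ) = 𝔤𝔩ₙ(K_w) ↪ 𝔤𝔩ₙ(K_∞)` at a complex place intertwines the conjugate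
transposes: `star (Y_w) = (Yᴴ)_w` (entrywise, `star` on `K_∞ = ℝ^{r₁} × ℂ^{r₂}` is complex
conjugation on the `ℂ`-factors). Knapp, *Lie Groups Beyond an Introduction*, I.§1. [folklore] -/
theorem star_complexPlaceLie (n : ℕ) (w : {w : InfinitePlace K // w.IsComplex})
    (Y : Matrix (Fin n) (Fin n) ℂ) :
    star (complexPlaceLie n w Y) = complexPlaceLie n w Yᴴ := by
  refine Matrix.ext fun i j => ?_
  simp only [Matrix.star_apply, complexPlaceLie_apply, Matrix.conjTranspose_apply, Prod.star_def,
    star_zero, Pi.single_star]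

variable [NumberField K]

/-- **`𝔲(n)_w ⊆ 𝔨`**: for a skew-Hermitian `Y ∈ 𝔤𝔩ₙ(ℂ)` (`Yᴴ = -Y`), its image `Y_w` in
`𝔤𝔩ₙ(K_∞)` at the complex place `w` lies in the compact Lie algebra `𝔨 = 𝔤 ⊓ 𝔲(n, K_∞)` of
`GLₙ(K_∞)`. Knapp, I.§1; Borel–Jacquet 1979, §4.1. [folklore] -/
theorem complexPlaceLie_mem_compactLie_archGroupGL (n : ℕ)
    (w : {w : InfinitePlace K // w.IsComplex}) {Y : Matrix (Fin n) (Fin n) ℂ} (hY : Yᴴ = -Y) :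
    complexPlaceLie n w Y ∈ (archGroupGL n K).compactLie := by
  rw [RealMatrixGroup.mem_compactLie_iff]
  exact ⟨trivial, by rw [star_complexPlaceLie, hY, map_neg]⟩

/-- In `K_∞ = ℝ^{r₁} × ℂ^{r₂}`, `exp (z_w) = 1` as soon as `e^z = 1` (`z_w = (0, single w z)`;
the exponential is computed coordinatewise). [folklore] -/
theorem exp_complexPlaceHom_of_exp_eq_one (w : {w : InfinitePlace K // w.IsComplex}) {z : ℂ}
    (hz : Complex.exp z = 1) : NormedSpace.exp (complexPlaceHom w z : mixedSpace K) = 1 := by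
  refine Prod.ext ?_ ?_
  · rw [Prod.fst_exp, complexPlaceHom_apply, Prod.fst_one]
    exact NormedSpace.exp_zero
  · rw [Prod.snd_exp, complexPlaceHom_apply, Prod.snd_one]
    funext w'
    rw [Pi.coe_exp, Pi.one_apply]
    change NormedSpace.exp
      ((Pi.single w z : {w : InfinitePlace K // w.IsComplex} → ℂ) w') = 1
    by_cases hw' : w' = w
    · subst hw'
      rw [Pi.single_eq_same, ← congr_fun Complex.exp_eq_exp_ℂ z, hz]
    · rw [Pi.single_eq_of_ne hw', NormedSpace.exp_zero]

/-- **Periodicity of the torus of `U(n)_w` in `K_∞`**: for `X ∈ 𝔨` with `X = (i E_{aa})_w`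
(`E_{aa} = Matrix.single a a 1`), `exp (2π X) = 1` in `K_∞`: the matrix `2π X` is diagonal with
the single non-zero entry `(2πi)_w`, and `e^{2πi} = 1`. Knapp, I.§1 (the torus of `U(n)`).
[folklore] -/
theorem expK_two_pi_smul_eq_one_of_coe_eq_complexPlaceLie_single (n : ℕ)
    (w : {w : InfinitePlace K // w.IsComplex}) (a : Fin n) (X : (archGroupGL n K).compactLie)
    (hX : (X : Matrix (Fin n) (Fin n) (mixedSpace K)) =
      complexPlaceLie n w (Matrix.single a a Complex.I)) :
    (archGroupGL n K).expK ((2 * Real.pi) • X) = 1 := by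
  refine Subtype.ext (Units.ext ?_)
  change NormedSpace.exp ((2 * Real.pi) • (X : Matrix (Fin n) (Fin n) (mixedSpace K))) = 1
  rw [hX, ← map_smul, Matrix.smul_single, ← Matrix.diagonal_single]
  change NormedSpace.exp ((Matrix.diagonal (Pi.single a ((2 * Real.pi) • Complex.I))).map
    (complexPlaceHom w)) = 1
  rw [Matrix.diagonal_map (map_zero _), Matrix.exp_diagonal, ← Matrix.diagonal_one]
  congr 1
  funext m
  rw [Pi.coe_exp]
  by_cases hm : m = a
  · subst hm
    rw [Pi.single_eq_same]
    refine exp_complexPlaceHom_of_exp_eq_one w ?_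
    rw [Complex.real_smul, ← Complex.exp_two_pi_mul_I]
    congr 1
    push_cast
    ring
  · rw [Pi.single_eq_of_ne hm, map_zero, NormedSpace.exp_zero]

/-- **Torus integrality and `U(2)`-stable finite-dimensional subspaces at a complex place.**
Let `π = W / W'` be an automorphic representation datum of `GL₂(𝔸_K)` and `w` a complex place of
`K`; `π.lieRep` is the action of `𝔤_∞ = 𝔤𝔩₂(K_∞)` by Lie derivatives.
(a) Every `x ∈ W / W'` lies in a finite-dimensional subspace `U` stable under
`π.lieRep (Y_w)` for all skew-Hermitian `Y ∈ 𝔲(2)`: take the span of the `K_∞`-orbit of `x`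
(finite-dimensional by `K`-finiteness, `K_∞`-stable), which is `𝔨`-stable since a subspace stable
under the one-parameter group `exp (t Y_w) ⊆ K_∞` is stable under its generator.
(b) The weights of the torus are integral: if `π.lieRep ((i E_{aa})_w) u = c u` with `u ≠ 0`
then `c = m i` for some `m ∈ ℤ`, since `u` transforms under `exp (t (i E_{aa})_w)` by `e^{ct}`
and `exp (2π (i E_{aa})_w) = 1`, so `e^{2π c} = 1`.  These are the `(𝔤, K)`-module inputs
(Wallach, *Real Reductive Groups I*, §3.3.1) of the minimal-`U(2)`-type analysis of the
`GL₂(ℂ)`-component of `π` (Clozel 1990, §3.3). [folklore] -/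
theorem AutomorphicRepData.torusIntegrality_complexPlace_glTwo :
    ∀ {K : Type} [Field K] [NumberField K] {hcpt : isCompact_glFiniteIntegralLevel 2 K}
      (π : AutomorphicRepData (AutomorphyDatum.gl 2 K hcpt))
      (w : {w : InfinitePlace K // w.IsComplex}),
      (∀ x : π.Quot, ∃ U : Submodule ℂ π.Quot, FiniteDimensional ℂ U ∧ x ∈ U ∧
        ∀ Y : Matrix (Fin 2) (Fin 2) ℂ, Yᴴ = -Y →
          ∀ u ∈ U, π.lieRep ⟨complexPlaceLie 2 w Y, trivial⟩ u ∈ U) ∧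
      (∀ (a : Fin 2) (u : π.Quot) (c : ℂ), u ≠ 0 →
        π.lieRep ⟨complexPlaceLie 2 w (Matrix.single a a Complex.I), trivial⟩ u = c • u →
          ∃ m : ℤ, c = m * Complex.I) := by
  intro K _ _ hcpt π w
  -- `W / W'` is a `(𝔤, K)`-module (Borel–Jacquet 4.6; tree)
  have hGK : IsGKModule (AutomorphyDatum.gl 2 K hcpt).arch π.kRep π.lieRep :=
    π.isGKModule_of_hasLieAction_holds (AutomorphyDatum.isRegular_gl hcpt) π.hasLieAction_lieRep
  refine ⟨fun x => ?_, fun a u c hu0 hu => ?_⟩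
  · -- (a) the span of the `K_∞`-orbit of `x`
    let U : Submodule ℂ π.Quot := Submodule.span ℂ
      (Set.range fun k : (AutomorphyDatum.gl 2 K hcpt).arch.maximalCompact ↦ π.kRep k x)
    haveI hfin : FiniteDimensional ℂ U := hGK.kFinite x
    have hxU : x ∈ U := by
      have : π.kRep 1 x = x := by rw [map_one, Module.End.one_apply]
      exact Submodule.subset_span ⟨1, this⟩
    have hUK : ∀ (k : (AutomorphyDatum.gl 2 K hcpt).arch.maximalCompact), ∀ u ∈ U,
        π.kRep k u ∈ U := by
      intro k u hu
      induction hu using Submodule.span_induction with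
      | mem y hy =>
        obtain ⟨k', rfl⟩ := hy
        rw [← Module.End.mul_apply, ← map_mul]
        exact Submodule.subset_span ⟨k * k', rfl⟩
      | zero => rw [map_zero]; exact zero_mem _
      | add y z _ _ hy hz => rw [map_add]; exact add_mem hy hz
      | smul b y _ hy => rw [map_smul]; exact Submodule.smul_mem _ _ hy
    refine ⟨U, hfin, hxU, fun Y hY u hu => ?_⟩
    -- a `K_∞`-stable subspace is stable under the generator `Y_w ∈ 𝔨` of `exp (t Y_w) ⊆ K_∞`
    exact hGK.apply_mem_of_expK_stable
      ⟨complexPlaceLie 2 w Y, complexPlaceLie_mem_compactLie_archGroupGL 2 w hY⟩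
      (fun t u hu => hUK _ u hu) hu
  · -- (b) periodicity of the torus quantises the weights
    have hskew : (Matrix.single a a Complex.I)ᴴ = -Matrix.single a a Complex.I := by
      rw [Matrix.conjTranspose_single, Complex.star_def, Complex.conj_I, Matrix.single_neg]
    -- the generator `X = (i E_{aa})_w ∈ 𝔨` of the `a`-th circle of the torus of `U(2)_w`
    set X : (AutomorphyDatum.gl 2 K hcpt).arch.compactLie :=
      ⟨complexPlaceLie 2 w (Matrix.single a a Complex.I),
        complexPlaceLie_mem_compactLie_archGroupGL 2 w hskew⟩
    -- `exp (2π X) = 1` in `K_∞`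
    have hT : (AutomorphyDatum.gl 2 K hcpt).arch.expK ((2 * Real.pi) • X) = 1 :=
      expK_two_pi_smul_eq_one_of_coe_eq_complexPlaceLie_single 2 w a X rfl
    -- `e^{2π c} = 1`, i.e. `2π c ∈ 2πi ℤ`
    have hexp := hGK.exp_mul_eq_one_of_eigenvector X hu hu0 hT
    obtain ⟨m, hm⟩ := Complex.exp_eq_one_iff.1 hexp
    refine ⟨m, ?_⟩
    have h2π : ((2 * Real.pi : ℝ) : ℂ) ≠ 0 := by
      exact_mod_cast mul_ne_zero two_ne_zero Real.pi_ne_zero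
    apply mul_right_cancel₀ h2π
    rw [hm]
    push_cast
    ring

end Literature.NumberTheory.Automorphic

end
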